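import Summits.HodgeConjecture.HodgeConjecture.Theorems.R90S6SemilinearHaarModuli          -- TJ1 FILE A: `map_prod_prod_twistedCoord` (the σ-semilinear Haar moduli), `twistedJacobian_eq_inv_normAbs_norm` (norm letters)
import Summits.HodgeConjecture.HodgeConjecture.Theorems.K2E3GL3BorelUnipotentHaar          -- ★ K2E3-p11: `e(x,y,z)` coordinates on `N₃`, `coord_inv`, `exists_haar_eq_smul_map_coord`
import Literature.NumberTheory.Automorphic.UnitaryGroupCongruenceIwahoriFactorisation       -- ★ `UnitaryGroup.qsInvolution`, `coe_qsInvolution_apply` (`Θ_σ(g) i j = σ(g⁻¹ (rev j) (rev i))`), `qsInvolution_mul`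
import HarnessLib

/-!
# R90 · S6 «Ch. 14.1–14.5 stable TF» — CARD TJ1 (row E1.4.4.2.1, hyperbolic clause): THE ε-TWISTED UNIPOTENT JACOBIAN ON `GL₃(K)`
# = THE `U(3)` UNIPOTENT JACOBIAN AT THE NORM (`Theorems/R90S6TwistedUnipotentJacobian.lean`, FILE B = the HEADS; FILE A = ★ `R90S6SemilinearHaarModuli`)

Cell `hodgecm-mathlib`, crux H413 (`stmt-HodgeConjecture-24833`), route of record `HCCMUnconditional`; programme R90-TF (brief
`director/R90-BRIEF.v2.md`), section S6 (base `R90-C14`), seat R90-C14-p06 (g2); S6 dealer R90-C14-plan (g2) CARD TJ1 2026-09-05T02:01:52Z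
(«the Jacobian COMPUTATION … consumed by name by p01 (g2)'s TB2a `hJac` letter»).  Lane `--kind proof --supports stmt-HodgeConjecture-24833 --as helper`;
THEOREMS ONLY (no definition ∕ instance ∕ notation ∕ named fact ∕ `sorry`).

THE MATHEMATICS [Rogawski1990, §4.10, proof of Prop. 4.10.2, p. 59: «`∫_{Z̃M̃^{1−ε}∖M̃} D_G(N(δ)) Φ_ε(δ, φ) …`»; Kottwitz 1986 (base change
for units) §1].  `K` a non-archimedean local field with a continuous involution `σ` (`K = E_w`, `σ` the conjugation of `E_w ∕ F_v` at a place
`v` of `F` that does not split), `Θ = Θ_σ` the quasi-split involution `g ↦ w⁰ ᵗ(σg)⁻¹ w⁰` of `GL₃(K)` (★ `UnitaryGroup.qsInvolution`), `N₃` the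
upper unitriangular group `upperUnitriangular (Fin 3) K` (= ★ `unipotentRadicalGL K id` by `rfl`) with its coordinates `e(x,y,z) = [[1,x,z],[0,1,y],[0,0,1]]`
(★ `K2E3GL3BorelUnipotentHaar`), `δ = diag(d₀,d₁,d₂)`; measurability on `N₃` is induced from `[MeasurableSpace (GL (Fin 3) K)] [BorelSpace _]`.
In coordinates (§1)
  `Θ(e(x,y,z)) = e(−σy, −σx, σxσy − σz)`,   `n·δ·Θ(n)⁻¹ = δ·ψ_δ(n)`,   `ψ_δ(e(x,y,z)) = e(px + σy, σx + qy, cz + σz + p·xσx)`,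
`p = d₁∕d₀`, `q = d₂∕d₁`, `c = d₂∕d₀`: the twisted commutator `ψ_δ` is a shear (Haar-preserving) glued to the two ADDITIVE (σ-semilinear)
graded pieces `L₁(x,y) = (px + σy, σx + qy)` on `K²` and `L₂ z = cz + σz` on `K`, whose Haar modules are (FILE A)
  **`mod(L₁) = ‖q·σ(p) − 1‖_K`** (`L₁ = shear ∘ diag(p, q − 1∕σp) ∘ shear`, `‖σp‖ = ‖p‖`),
  **`mod(L₂) = √‖1 − c·σ(c)‖_K`** (`L₂ = σ ∘ (1 + S)`, `S z = σ(c)σ(z)`, `S² = cσ(c)`, `(1 + S)(1 − S) = 1 − cσ(c)` and `1 ± S` conjugate by a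
  skew element, so both have module `√‖1 − cσc‖` — no subfield is ever named),
`‖·‖ = normAbs K` (★ `map_mul_left_addHaar`; Haar characters ★ `LocalFieldLinearJacobian`).  Hence (§2), for EVERY Haar measure `μN` on `N₃`,
every measurable `Φ ≥ 0` and every ε-REGULAR diagonal `δ` (`qσp ≠ 1`, `cσc ≠ 1`):
  **`∫⁻_{N₃} Φ(n·δ·Θ(n)⁻¹) dμN = J(δ) · ∫⁻_{N₃} Φ(δ·n) dμN`,  `J(δ) = (‖qσp − 1‖_K · √‖1 − cσc‖_K)⁻¹`**,
the same on the whole twisted torus orbit `a·δ·Θ(a)⁻¹` (`a` diagonal; the two letters are invariant), which is the `hJac` letter of the ε-twisted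
torus descent (p01's TB2a, left convention of ★ `descEpsConj`).  §3 reads `J` at the NORM `γ = N(δ) = δ·Θ(δ) = diag(d₀∕σd₂, d₁∕σd₁, d₂∕σd₀)`:
with `a = γ₀⁻¹γ₁`, `b = γ₀⁻¹γ₂` (`∈ K^σ`), `‖qσp − 1‖ = ‖a − 1‖` and `‖1 − cσc‖ = ‖b − 1‖`, so **`J(δ) = (‖a − 1‖ · √‖b − 1‖)⁻¹`** — byte-shape of the
`U(3)` unipotent Jacobian `J(t) = (‖a−1‖·√‖b−1‖)⁻¹` of ★ `HeisRing.twistModule_eq_inv` ∕ ★ `twistModule_cmLocal_eq` at `t = N(δ)`: «the ε-twisted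
unipotent Jacobian at `δ` is the Weyl discriminant `D_G` at the norm» (print p. 59), with no `δ_B` residue in the left form.

HONEST LABEL: local change-of-variables bookkeeping for E1.4.4.2.1, count-neutral until TB2a ∕ TB2d consume it; proves no printed global statement,
discharges no citation; the identification `LocalRing L v ≅ L_w` at a non-split `v` (to read ★ `twistModule_cmLocal_eq` literally) is not made here.
HC_CM is proved only modulo the 7 printed citations (2 remaining named inputs: hLiu418 = stmt-HodgeConjecture-24832, h413 = stmt-HodgeConjecture-24833)
until rung 0 closes; REL ≠ ★ ≠ BUILT.

## Tree search
★ `exists_coordHomeomorph`, `coord_inv`, `exists_haar_eq_smul_map_coord`, `map_coordScale`, `isInvInvariant_haar_borelUnipotentGL3`,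
`exists_homeomorph_conj_diagonal_eq_mul` (the UNTWISTED twin) [Theorems/K2E3GL3BorelUnipotentHaar]; ★ `UnitaryGroup.coe_qsInvolution_apply`,
`qsInvolution_mul` [UnitaryGroupCongruenceIwahoriFactorisation, U3LocalBruhatDecompositionProofs]; ★ `map_mul_left_addHaar`, `addHaar_smul_set`,
`normAbs_neg` [TateLocalZetaShells, AddCharConductorExponent]; FILE A ★ `R90S6SemilinearHaarModuli` (`map_prod_prod_twistedCoord`, `twistedJacobian_eq_inv_normAbs_norm`); ★ `HeisRing.twistModule_eq_inv` ∕
`twistModule_cmLocal_eq` [UnitaryGroupRegularTwistModulus] = the `U(3)` letters matched in §3 (not imported); Mathlib `lintegral_map_equiv`, `lintegral_map`, `lintegral_smul_measure`.  ★ `GLnLeviOrbitalDescent` hard-wires `Ad(p)` on an abelian box (no 2-step filtration): not reusable here.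
Dedup: `rg "qsInvolution_coord|qsInvolution_inv_coord|twistedOrbit|weylDiscriminant_norm|TwistedUnipotentJacobian"` over `lean/` — no hit.

## References
* [Rogawski1990] J. D. Rogawski, *Automorphic Representations of Unitary Groups in Three Variables*, Ann. of Math. Stud. 123 (1990), §4.10 Prop. 4.10.2
  and its proof pp. 58–59; §4.9 (4.9.1)–(4.9.2) p. 55; §4.13 p. 70.
* [Kottwitz1986BaseChangeUnits] R. Kottwitz, *Base change for unit elements of Hecke algebras*, Compositio Math. 60 (1986), §1 pp. 239–240.
* [WeilBNT1967] A. Weil, *Basic Number Theory* (1967), Ch. I §2 (modules of automorphisms).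
-/

set_option autoImplicit false
-- the mandated namespace repeats the single-problem summit's segment (`HodgeConjecture.HodgeConjecture`)
set_option linter.dupNamespace false

noncomputable section

open MeasureTheory Measure Filter Topology TopologicalSpace
open scoped MatrixGroups NNReal ENNReal
open Literature.NumberTheory.Automorphic
open Literature.NumberTheory.GaloisRepresentations Literature.NumberTheory.GaloisRepresentations.IsNonarchimedeanLocalField
open Summit.HodgeConjecture.HodgeConjecture.Cruxes.H413.K2E3GL3BorelUnipotentHaar

namespace Summit.HodgeConjecture.HodgeConjecture.R90.S6

/-! ## §1 `Θ_σ` and the twisted commutator `ψ_δ` in the coordinates `e(x,y,z)` of `N₃` -/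

section Coordinates

variable {K : Type*} [Field K] [TopologicalSpace K] (σ : K →+* K)
  (e : (K × K) × K ≃ₜ ↥(unipotentRadicalGL K (id : Fin 3 → Fin 3)))
  (he : ∀ p : (K × K) × K, (((e p : ↥(unipotentRadicalGL K (id : Fin 3 → Fin 3))) : GL (Fin 3) K) : Matrix (Fin 3) (Fin 3) K) =
    !![1, p.1.1, p.2; 0, 1, p.1.2; 0, 0, 1])
include he

/-- **`Θ_σ(e(x,y,z)) = e(−σy, −σx, σx·σy − σz)`**: the quasi-split involution on the upper unitriangular group in coordinates
(`Θ_σ(g) i j = σ(g⁻¹ (rev j) (rev i))` ★ `coe_qsInvolution_apply`, `e(x,y,z)⁻¹ = e(−x, −y, xy − z)` ★ `coord_inv`). [cite: Rogawski1990, §1.9–§1.10 pp. 8–9] -/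
theorem qsInvolution_coord (p : (K × K) × K) :
    UnitaryGroup.qsInvolution σ (((e p : ↥(unipotentRadicalGL K (id : Fin 3 → Fin 3))) : GL (Fin 3) K)) =
      ((e ((-σ p.1.2, -σ p.1.1), σ p.1.1 * σ p.1.2 - σ p.2) : ↥(unipotentRadicalGL K (id : Fin 3 → Fin 3))) : GL (Fin 3) K) := by
  have hinv : (((e p : ↥(unipotentRadicalGL K (id : Fin 3 → Fin 3))) : GL (Fin 3) K))⁻¹ =
      ((e ((-p.1.1, -p.1.2), p.1.1 * p.1.2 - p.2) : ↥(unipotentRadicalGL K (id : Fin 3 → Fin 3))) : GL (Fin 3) K) := by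
    rw [← Subgroup.coe_inv, coord_inv e he]
  apply Units.ext
  ext i j
  rw [UnitaryGroup.coe_qsInvolution_apply, hinv, he, he]
  fin_cases i <;> fin_cases j <;> simp [Fin.rev]

/-- **`n · δ · Θ_σ(n)⁻¹ = δ · ψ_δ(n)`** for `δ = diag(d)` and `n = e(x,y,z)`, with the TWISTED COMMUTATOR in coordinates
`ψ_δ(e(x,y,z)) = e(p x + σy, σx + q y, c z + σz + p·x·σx)`, `p = d₁∕d₀, q = d₂∕d₁, c = d₂∕d₀` (`δ⁻¹ n δ · Θ(n⁻¹)`).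
[cite: Rogawski1990, §4.10 p. 59] [cite: Kottwitz1986BaseChangeUnits, §1 p. 240] -/
theorem mul_diagonal_mul_qsInvolution_inv_coord (δ : GL (Fin 3) K) (d : Fin 3 → K) (hδ : (δ : Matrix (Fin 3) (Fin 3) K) = Matrix.diagonal d)
    (p : (K × K) × K) :
    (((e p : ↥(unipotentRadicalGL K (id : Fin 3 → Fin 3))) : GL (Fin 3) K)) * δ *
        (UnitaryGroup.qsInvolution σ (((e p : ↥(unipotentRadicalGL K (id : Fin 3 → Fin 3))) : GL (Fin 3) K)))⁻¹ =
      δ * ((e ((d 1 / d 0 * p.1.1 + σ p.1.2, σ p.1.1 + d 2 / d 1 * p.1.2),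
              d 2 / d 0 * p.2 + σ p.2 + d 1 / d 0 * p.1.1 * σ p.1.1) : ↥(unipotentRadicalGL K (id : Fin 3 → Fin 3))) : GL (Fin 3) K) := by
  -- the entries of `δ` are non-zero
  have hdet : (Matrix.diagonal d).det ≠ 0 := by
    rw [← hδ, ← Matrix.GeneralLinearGroup.val_det_apply]; exact (Matrix.GeneralLinearGroup.det δ).ne_zero
  rw [Matrix.det_diagonal] at hdet
  have hd : ∀ i, d i ≠ 0 := fun i => (Finset.prod_ne_zero_iff.1 hdet) i (Finset.mem_univ i)
  obtain ⟨hd0, hd1, hd2⟩ : d 0 ≠ 0 ∧ d 1 ≠ 0 ∧ d 2 ≠ 0 := ⟨hd 0, hd 1, hd 2⟩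
  have hinv : (UnitaryGroup.qsInvolution σ (((e p : ↥(unipotentRadicalGL K (id : Fin 3 → Fin 3))) : GL (Fin 3) K)))⁻¹ =
      ((e ((σ p.1.2, σ p.1.1), σ p.2) : ↥(unipotentRadicalGL K (id : Fin 3 → Fin 3))) : GL (Fin 3) K) := by
    rw [qsInvolution_coord σ e he, ← Subgroup.coe_inv, coord_inv e he]
    congr 2
    ext <;> simp
    ring
  rw [hinv]
  apply Units.ext
  have hdiag : (Matrix.diagonal d : Matrix (Fin 3) (Fin 3) K) = !![d 0, 0, 0; 0, d 1, 0; 0, 0, d 2] := by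
    ext i j
    fin_cases i <;> fin_cases j <;> simp
  simp only [Units.val_mul, he, hδ, hdiag]
  ext i j
  fin_cases i <;> fin_cases j <;> simp [Matrix.mul_apply, Fin.sum_univ_three] <;> field_simp <;> ring

end Coordinates

/-! ## §2 THE ε-TWISTED ORBITAL SUBSTITUTION on `N₃ ≤ GL₃(K)`: `∫⁻ Φ(n·δ·Θ(n)⁻¹) dμN = J(δ) · ∫⁻ Φ(δ·n) dμN` -/

section Diagonal

variable {K : Type*} [Field K] (σ : K →+* K)

/-- the entries of a diagonal element of `GL₃` are non-zero. [folklore] -/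
private theorem diagonal_entries_ne_zero (δ : GL (Fin 3) K) (d : Fin 3 → K) (hδ : (δ : Matrix (Fin 3) (Fin 3) K) = Matrix.diagonal d) (i : Fin 3) :
    d i ≠ 0 := by
  have hdet : (Matrix.diagonal d).det ≠ 0 := by
    rw [← hδ, ← Matrix.GeneralLinearGroup.val_det_apply]; exact (Matrix.GeneralLinearGroup.det δ).ne_zero
  rw [Matrix.det_diagonal] at hdet
  exact (Finset.prod_ne_zero_iff.1 hdet) i (Finset.mem_univ i)

/-- the matrix of `a · δ · Θ(a)⁻¹` for diagonal `a = diag(α)`, `δ = diag(d)`: `diag(α₀d₀σ(α₂), α₁d₁σ(α₁), α₂d₂σ(α₀))`. [cite: Rogawski1990, §4.10 p. 58] -/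
private theorem coe_twistedOrbit_diagonal {a δ : GL (Fin 3) K} {α d : Fin 3 → K} (haα : (a : Matrix (Fin 3) (Fin 3) K) = Matrix.diagonal α)
    (hδ : (δ : Matrix (Fin 3) (Fin 3) K) = Matrix.diagonal d) :
    ((a * δ * (UnitaryGroup.qsInvolution σ a)⁻¹ : GL (Fin 3) K) : Matrix (Fin 3) (Fin 3) K) =
      Matrix.diagonal ![α 0 * d 0 * σ (α 2), α 1 * d 1 * σ (α 1), α 2 * d 2 * σ (α 0)] := by
  -- `Θ(a)⁻¹ = Θ(a⁻¹)` and its entries are `σ(a (rev j) (rev i))`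
  have hinv : (UnitaryGroup.qsInvolution σ a)⁻¹ = UnitaryGroup.qsInvolution σ a⁻¹ := by
    refine inv_eq_of_mul_eq_one_right ?_
    rw [← UnitaryGroup.qsInvolution_mul, mul_inv_cancel]
    have h := UnitaryGroup.qsInvolution_mul σ (1 : GL (Fin 3) K) 1
    rw [one_mul] at h
    exact mul_eq_left.1 h.symm
  have hΘ : ∀ i j, ((UnitaryGroup.qsInvolution σ a⁻¹ : GL (Fin 3) K) : Matrix (Fin 3) (Fin 3) K) i j = σ (Matrix.diagonal α j.rev i.rev) := by
    intro i j
    rw [UnitaryGroup.coe_qsInvolution_apply, inv_inv, haα]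
  have hdiagα : (Matrix.diagonal α : Matrix (Fin 3) (Fin 3) K) = !![α 0, 0, 0; 0, α 1, 0; 0, 0, α 2] := by
    ext i j; fin_cases i <;> fin_cases j <;> simp
  have hdiagd : (Matrix.diagonal d : Matrix (Fin 3) (Fin 3) K) = !![d 0, 0, 0; 0, d 1, 0; 0, 0, d 2] := by
    ext i j; fin_cases i <;> fin_cases j <;> simp
  have hΘm : ((UnitaryGroup.qsInvolution σ a⁻¹ : GL (Fin 3) K) : Matrix (Fin 3) (Fin 3) K) = !![σ (α 2), 0, 0; 0, σ (α 1), 0; 0, 0, σ (α 0)] := by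
    ext i j
    rw [hΘ, hdiagα]
    fin_cases i <;> fin_cases j <;> simp [Fin.rev]
  rw [hinv, Units.val_mul, Units.val_mul, haα, hδ, hΘm, hdiagα, hdiagd]
  ext i j
  fin_cases i <;> fin_cases j <;> simp [Matrix.mul_apply, Fin.sum_univ_three, Matrix.diagonal]

end Diagonal

section Orbital

variable {K : Type*} [Field K] [ValuativeRel K] [TopologicalSpace K] [IsNonarchimedeanLocalField K]
  [MeasurableSpace K] [BorelSpace K] [MeasurableSpace (GL (Fin 3) K)] [BorelSpace (GL (Fin 3) K)]
  (σ : K →+* K) (hσ : ∀ x, σ (σ x) = x) (hσc : Continuous σ)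

include hσ hσc in
/-- HEAD 1 in the spelling `unipotentRadicalGL K id` of ★ `K2E3GL3BorelUnipotentHaar` (the public heads below use the tree's standard spelling
`upperUnitriangular (Fin 3) K`, which is this subgroup by `rfl` but not by instance search). [cite: Rogawski1990, §4.10 Prop. 4.10.2 proof p. 59] -/
private theorem lintegral_mul_mul_qsInvolution_inv_eq_mul_aux (hσ1 : ∃ x, σ x ≠ x)
    (δ : GL (Fin 3) K) (d : Fin 3 → K) (hδ : (δ : Matrix (Fin 3) (Fin 3) K) = Matrix.diagonal d)
    (ha : d 2 / d 1 * σ (d 1 / d 0) - 1 ≠ 0) (hb : 1 - d 2 / d 0 * σ (d 2 / d 0) ≠ 0)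
    (μN : Measure ↥(unipotentRadicalGL K (id : Fin 3 → Fin 3))) [IsHaarMeasure μN]
    (Φ : GL (Fin 3) K → ℝ≥0∞) (hΦ : Measurable Φ) :
    ∫⁻ n, Φ ((n : GL (Fin 3) K) * δ * (UnitaryGroup.qsInvolution σ (n : GL (Fin 3) K))⁻¹) ∂μN =
      ((((normAbs K (d 2 / d 1 * σ (d 1 / d 0) - 1))⁻¹ * (NNReal.sqrt (normAbs K (1 - d 2 / d 0 * σ (d 2 / d 0))))⁻¹ : ℝ≥0)) : ℝ≥0∞) *
        ∫⁻ n, Φ (δ * (n : GL (Fin 3) K)) ∂μN := by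
  haveI : T2Space K := (isLocalField K).toT2Space
  haveI : LocallyCompactSpace K := (isLocalField K).toLocallyCompactSpace
  haveI : SecondCountableTopology K := secondCountableTopology_localField K
  haveI : IsTopologicalRing K := inferInstance
  haveI : BorelSpace ↥(unipotentRadicalGL K (id : Fin 3 → Fin 3)) := Subtype.borelSpace _
  have hd := diagonal_entries_ne_zero δ d hδ
  have hp : d 1 / d 0 ≠ 0 := div_ne_zero (hd 1) (hd 0)
  obtain ⟨e, he⟩ := exists_coordHomeomorph (R := K)
  obtain ⟨C, -, hμ⟩ := exists_haar_eq_smul_map_coord e he Measure.addHaar μN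
  set vol : Measure ((K × K) × K) := ((Measure.addHaar : Measure K).prod Measure.addHaar).prod Measure.addHaar with hvol
  -- the twisted commutator in coordinates
  set ψ : (K × K) × K → (K × K) × K := fun v =>
    ((d 1 / d 0 * v.1.1 + σ v.1.2, σ v.1.1 + d 2 / d 1 * v.1.2), d 2 / d 0 * v.2 + σ v.2 + d 1 / d 0 * v.1.1 * σ v.1.1) with hψ
  have hψm : Measurable ψ :=
    ((((continuous_const.mul (continuous_fst.comp continuous_fst)).add (hσc.comp (continuous_snd.comp continuous_fst))).prodMk
      ((hσc.comp (continuous_fst.comp continuous_fst)).add (continuous_const.mul (continuous_snd.comp continuous_fst)))).prodMk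
      (((continuous_const.mul continuous_snd).add (hσc.comp continuous_snd)).add
        ((continuous_const.mul (continuous_fst.comp continuous_fst)).mul (hσc.comp (continuous_fst.comp continuous_fst))))).measurable
  have hψvol : vol.map ψ = ((((normAbs K (d 2 / d 1 * σ (d 1 / d 0) - 1))⁻¹ *
      (NNReal.sqrt (normAbs K (1 - d 2 / d 0 * σ (d 2 / d 0))))⁻¹ : ℝ≥0)) : ℝ≥0∞) • vol :=
    map_prod_prod_twistedCoord σ hσ hσc hσ1 (d 1 / d 0) (d 2 / d 1) (d 2 / d 0) hp ha hb Measure.addHaar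
  -- integrals against `e_* vol`
  have hmw : ∀ H : ↥(unipotentRadicalGL K (id : Fin 3 → Fin 3)) → ℝ≥0∞, ∫⁻ n, H n ∂(vol.map e) = ∫⁻ v, H (e v) ∂vol := fun H => by
    rw [← Homeomorph.toMeasurableEquiv_coe, lintegral_map_equiv]
  have hG : Measurable fun w : (K × K) × K => Φ (δ * (((e w : ↥(unipotentRadicalGL K (id : Fin 3 → Fin 3))) : GL (Fin 3) K))) :=
    hΦ.comp (continuous_const.mul (continuous_subtype_val.comp e.continuous)).measurable
  rw [hμ, lintegral_smul_measure, lintegral_smul_measure, hmw, hmw]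
  have hpt : ∀ v : (K × K) × K,
      Φ ((((e v : ↥(unipotentRadicalGL K (id : Fin 3 → Fin 3))) : GL (Fin 3) K)) * δ *
          (UnitaryGroup.qsInvolution σ (((e v : ↥(unipotentRadicalGL K (id : Fin 3 → Fin 3))) : GL (Fin 3) K)))⁻¹) =
        Φ (δ * (((e (ψ v) : ↥(unipotentRadicalGL K (id : Fin 3 → Fin 3))) : GL (Fin 3) K))) := fun v => by
    simp only [hψ, mul_diagonal_mul_qsInvolution_inv_coord σ e he δ d hδ v]
  have hsub : ∫⁻ v, Φ (δ * (((e (ψ v) : ↥(unipotentRadicalGL K (id : Fin 3 → Fin 3))) : GL (Fin 3) K))) ∂vol =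
      ∫⁻ w, Φ (δ * (((e w : ↥(unipotentRadicalGL K (id : Fin 3 → Fin 3))) : GL (Fin 3) K))) ∂(vol.map ψ) :=
    (lintegral_map hG hψm).symm
  simp_rw [hpt]
  rw [hsub, hψvol, lintegral_smul_measure]
  simp only [ENNReal.smul_def, smul_eq_mul]
  ring

include hσ hσc in
/-- **THE ε-TWISTED UNIPOTENT JACOBIAN (HEAD 1).**  `K` a non-archimedean local field with a continuous involution `σ ≠ id`, `Θ = Θ_σ` the
quasi-split involution of `GL₃(K)`, `N₃` the upper unitriangular group, `μN` ANY Haar measure on `N₃`, `δ = diag(d₀, d₁, d₂)` ε-REGULAR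
(`d₂∕d₁·σ(d₁∕d₀) ≠ 1` and `d₂∕d₀·σ(d₂∕d₀) ≠ 1`, i.e. the norm `N(δ)` is regular).  Then for every measurable `Φ ≥ 0` on `GL₃(K)`
**`∫⁻ Φ(n·δ·Θ(n)⁻¹) dμN(n) = J(δ) · ∫⁻ Φ(δ·n) dμN(n)`,  `J(δ) = (‖d₂∕d₁·σ(d₁∕d₀) − 1‖_K)⁻¹ · (√‖1 − d₂∕d₀·σ(d₂∕d₀)‖_K)⁻¹`** — the twisted
change of variables `n ↦ ψ_δ(n)` (`n δ Θ(n)⁻¹ = δ ψ_δ(n)`, §1) on the unipotent radical in the LEFT convention of ★ `descEpsConj`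
(`q.out·δ·(ε q.out)⁻¹`), with `μN = C • e_* vol` (★ `exists_haar_eq_smul_map_coord`) and FILE A `map_prod_prod_twistedCoord`.  [cite: Rogawski1990, §4.10 Prop. 4.10.2 proof p. 59]
[cite: Kottwitz1986BaseChangeUnits, §1 pp. 239–240] -/
theorem lintegral_mul_mul_qsInvolution_inv_eq_mul (hσ1 : ∃ x, σ x ≠ x)
    (δ : GL (Fin 3) K) (d : Fin 3 → K) (hδ : (δ : Matrix (Fin 3) (Fin 3) K) = Matrix.diagonal d)
    (ha : d 2 / d 1 * σ (d 1 / d 0) - 1 ≠ 0) (hb : 1 - d 2 / d 0 * σ (d 2 / d 0) ≠ 0)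
    (μN : Measure ↥(upperUnitriangular (Fin 3) K)) [IsHaarMeasure μN]
    (Φ : GL (Fin 3) K → ℝ≥0∞) (hΦ : Measurable Φ) :
    ∫⁻ n, Φ ((n : GL (Fin 3) K) * δ * (UnitaryGroup.qsInvolution σ (n : GL (Fin 3) K))⁻¹) ∂μN =
      ((((normAbs K (d 2 / d 1 * σ (d 1 / d 0) - 1))⁻¹ * (NNReal.sqrt (normAbs K (1 - d 2 / d 0 * σ (d 2 / d 0))))⁻¹ : ℝ≥0)) : ℝ≥0∞) *
        ∫⁻ n, Φ (δ * (n : GL (Fin 3) K)) ∂μN := by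
  -- `upperUnitriangular (Fin 3) K` is `unipotentRadicalGL K id` by definition: re-key the Haar instance and apply the aux head
  have hμN : IsHaarMeasure μN := ‹IsHaarMeasure μN›
  unfold upperUnitriangular at hμN
  haveI := hμN
  exact lintegral_mul_mul_qsInvolution_inv_eq_mul_aux σ hσ hσc hσ1 δ d hδ ha hb μN Φ hΦ

include hσ hσc in
/-- **THE ε-TWISTED UNIPOTENT JACOBIAN ON THE TWISTED TORUS ORBIT (HEAD 2 — the `hJac` letter of the ε-twisted torus descent).**
For `a` in the diagonal torus `A = standardLeviGL K id` the element `δ_a = a·δ·Θ(a)⁻¹` is again diagonal with the SAME two regularity letters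
(`d₂∕d₁·σ(d₁∕d₀)` and `d₂∕d₀·σ(d₂∕d₀)` are invariant, `N(δ_a) = N(δ)`), so with ONE constant `J(δ)`:
**`∫⁻ Φ(n·(aδΘ(a)⁻¹)·Θ(n)⁻¹) dμN = J(δ) · ∫⁻ Φ((aδΘ(a)⁻¹)·n) dμN`** for every Haar `μN` on `N₃`, every `a ∈ A`, every measurable `Φ ≥ 0`.
[cite: Rogawski1990, §4.10 Prop. 4.10.2 proof p. 59] [cite: Kottwitz1986BaseChangeUnits, §1 pp. 239–240] -/
theorem lintegral_mul_twistedOrbit_mul_qsInvolution_inv_eq_mul (hσ1 : ∃ x, σ x ≠ x)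
    (δ : GL (Fin 3) K) (d : Fin 3 → K) (hδ : (δ : Matrix (Fin 3) (Fin 3) K) = Matrix.diagonal d)
    (ha : d 2 / d 1 * σ (d 1 / d 0) - 1 ≠ 0) (hb : 1 - d 2 / d 0 * σ (d 2 / d 0) ≠ 0)
    (μN : Measure ↥(upperUnitriangular (Fin 3) K)) [IsHaarMeasure μN]
    {a : GL (Fin 3) K} (haA : a ∈ standardLeviGL K (id : Fin 3 → Fin 3))
    (Φ : GL (Fin 3) K → ℝ≥0∞) (hΦ : Measurable Φ) :
    ∫⁻ n, Φ ((n : GL (Fin 3) K) * (a * δ * (UnitaryGroup.qsInvolution σ a)⁻¹) * (UnitaryGroup.qsInvolution σ (n : GL (Fin 3) K))⁻¹) ∂μN =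
      ((((normAbs K (d 2 / d 1 * σ (d 1 / d 0) - 1))⁻¹ * (NNReal.sqrt (normAbs K (1 - d 2 / d 0 * σ (d 2 / d 0))))⁻¹ : ℝ≥0)) : ℝ≥0∞) *
        ∫⁻ n, Φ (a * δ * (UnitaryGroup.qsInvolution σ a)⁻¹ * (n : GL (Fin 3) K)) ∂μN := by
  -- `a = diag(α)`, `α i = a i i ≠ 0`
  set α : Fin 3 → K := fun i => (a : Matrix (Fin 3) (Fin 3) K) i i with hα
  have haα : (a : Matrix (Fin 3) (Fin 3) K) = Matrix.diagonal α := by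
    ext i j
    by_cases hij : i = j
    · subst hij; rw [Matrix.diagonal_apply_eq]
    · rw [Matrix.diagonal_apply_ne _ hij]
      exact (mem_standardLeviGL_iff (id : Fin 3 → Fin 3) a).1 haA i j hij
  have hαne := diagonal_entries_ne_zero a α haα
  have hd := diagonal_entries_ne_zero δ d hδ
  have hσne : ∀ i, σ (α i) ≠ 0 := fun i h => hαne i (by rw [← hσ (α i), h, map_zero])
  have hσd : ∀ i, σ (d i) ≠ 0 := fun i h => hd i (by rw [← hσ (d i), h, map_zero])
  -- `δ_a = diag(d′)` with the same regularity letters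
  have hδ' := coe_twistedOrbit_diagonal σ haα hδ
  have h1 : (![α 0 * d 0 * σ (α 2), α 1 * d 1 * σ (α 1), α 2 * d 2 * σ (α 0)] 2 / ![α 0 * d 0 * σ (α 2), α 1 * d 1 * σ (α 1), α 2 * d 2 * σ (α 0)] 1 *
        σ (![α 0 * d 0 * σ (α 2), α 1 * d 1 * σ (α 1), α 2 * d 2 * σ (α 0)] 1 / ![α 0 * d 0 * σ (α 2), α 1 * d 1 * σ (α 1), α 2 * d 2 * σ (α 0)] 0) : K) =
      d 2 / d 1 * σ (d 1 / d 0) := by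
    have h0 := hαne 0; have h1 := hαne 1; have h2 := hαne 2; have s0 := hσne 0; have s1 := hσne 1; have s2 := hσne 2
    have e0 := hd 0; have e1 := hd 1; have t0 := hσd 0; have t1 := hσd 1
    simp only [Matrix.cons_val_zero, Matrix.cons_val_one, Matrix.cons_val_two, Matrix.head_cons, Matrix.tail_cons, map_mul, map_div₀, hσ]
    field_simp
  have h2 : (![α 0 * d 0 * σ (α 2), α 1 * d 1 * σ (α 1), α 2 * d 2 * σ (α 0)] 2 / ![α 0 * d 0 * σ (α 2), α 1 * d 1 * σ (α 1), α 2 * d 2 * σ (α 0)] 0 *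
        σ (![α 0 * d 0 * σ (α 2), α 1 * d 1 * σ (α 1), α 2 * d 2 * σ (α 0)] 2 / ![α 0 * d 0 * σ (α 2), α 1 * d 1 * σ (α 1), α 2 * d 2 * σ (α 0)] 0) : K) =
      d 2 / d 0 * σ (d 2 / d 0) := by
    have h0 := hαne 0; have h2 := hαne 2; have s0 := hσne 0; have s2 := hσne 2
    have e0 := hd 0; have e2 := hd 2; have t0 := hσd 0; have t2 := hσd 2
    simp only [Matrix.cons_val_zero, Matrix.cons_val_two, Matrix.head_cons, Matrix.tail_cons, map_mul, map_div₀, hσ]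
    field_simp
  have key := lintegral_mul_mul_qsInvolution_inv_eq_mul σ hσ hσc hσ1 (a * δ * (UnitaryGroup.qsInvolution σ a)⁻¹)
    ![α 0 * d 0 * σ (α 2), α 1 * d 1 * σ (α 1), α 2 * d 2 * σ (α 0)] hδ' (by rw [h1]; exact ha) (by rw [h2]; exact hb) μN Φ hΦ
  rw [h1, h2] at key
  exact key

include hσ hσc in
/-- **HEAD 2 IN THE EXACT SHAPE OF THE `hJac` LETTER of the ε-twisted torus descent (p01's `R90S6TwistedTorusDescent`, `GL₃` edition):**
for a torus `A = standardLeviGL K id` given by an equation `hAid` and `ε = Θ_σ`,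
`∀ a : ↥A, ∀ Φ measurable, ∫⁻ u, Φ(u·(aδΘ(a)⁻¹)·Θ(u)⁻¹) ∂μN = J(δ) · ∫⁻ u, Φ((aδΘ(a)⁻¹)·u) ∂μN` with the ONE constant
`J(δ) = (‖d₂∕d₁·σ(d₁∕d₀) − 1‖ · √‖1 − d₂∕d₀·σ(d₂∕d₀)‖)⁻¹`. [cite: Rogawski1990, §4.10 Prop. 4.10.2 proof p. 59] [cite: Kottwitz1986BaseChangeUnits, §1 pp. 239–240] -/
theorem lintegral_twistedTorusOrbit_hJac (hσ1 : ∃ x, σ x ≠ x)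
    (δ : GL (Fin 3) K) (d : Fin 3 → K) (hδ : (δ : Matrix (Fin 3) (Fin 3) K) = Matrix.diagonal d)
    (ha : d 2 / d 1 * σ (d 1 / d 0) - 1 ≠ 0) (hb : 1 - d 2 / d 0 * σ (d 2 / d 0) ≠ 0)
    (μN : Measure ↥(upperUnitriangular (Fin 3) K)) [IsHaarMeasure μN]
    {A : Subgroup (GL (Fin 3) K)} (hAid : A = standardLeviGL K (id : Fin 3 → Fin 3)) :
    ∀ a : ↥A, ∀ Φ : GL (Fin 3) K → ℝ≥0∞, Measurable Φ →
      ∫⁻ u, Φ ((u : GL (Fin 3) K) * ((a : GL (Fin 3) K) * δ * (UnitaryGroup.qsInvolution σ (a : GL (Fin 3) K))⁻¹) *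
          (UnitaryGroup.qsInvolution σ (u : GL (Fin 3) K))⁻¹) ∂μN =
        ((((normAbs K (d 2 / d 1 * σ (d 1 / d 0) - 1))⁻¹ * (NNReal.sqrt (normAbs K (1 - d 2 / d 0 * σ (d 2 / d 0))))⁻¹ : ℝ≥0)) : ℝ≥0∞) *
          ∫⁻ u, Φ (((a : GL (Fin 3) K) * δ * (UnitaryGroup.qsInvolution σ (a : GL (Fin 3) K))⁻¹) * (u : GL (Fin 3) K)) ∂μN :=
  fun a Φ hΦ => lintegral_mul_twistedOrbit_mul_qsInvolution_inv_eq_mul σ hσ hσc hσ1 δ d hδ ha hb μN (hAid ▸ a.2) Φ hΦ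

end Orbital

/-! ## §3 The Jacobian read at the norm `γ = N(δ) = δ·Θ(δ)`: `J(δ) = (‖a − 1‖·√‖b − 1‖)⁻¹`, `a = γ₀⁻¹γ₁`, `b = γ₀⁻¹γ₂` -/

section Norm

variable {K : Type*} [Field K] [ValuativeRel K] [TopologicalSpace K] [IsNonarchimedeanLocalField K]
  [MeasurableSpace K] [BorelSpace K]
  (σ : K →+* K) (hσ : ∀ x, σ (σ x) = x) (hσc : Continuous σ)

omit [ValuativeRel K] [TopologicalSpace K] [IsNonarchimedeanLocalField K] [MeasurableSpace K] [BorelSpace K] in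
/-- **The norm of a diagonal element: `N(δ) = δ·Θ(δ) = diag(d₀∕σ(d₂), d₁∕σ(d₁), d₂∕σ(d₀))`** (`Θ(diag d) = diag(σ(d₂)⁻¹, σ(d₁)⁻¹, σ(d₀)⁻¹)`,
★ `coe_qsInvolution_apply`) — the dictionary `δ = d(x,y,z) ↦ γ = N(δ) = d(x∕z̄, y∕ȳ, z∕x̄)` of the proof of Prop. 4.10.2.
[cite: Rogawski1990, §4.10 p. 58–59] -/
theorem coe_mul_qsInvolution_of_diagonal (δ : GL (Fin 3) K) (d : Fin 3 → K) (hδ : (δ : Matrix (Fin 3) (Fin 3) K) = Matrix.diagonal d) :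
    ((δ * UnitaryGroup.qsInvolution σ δ : GL (Fin 3) K) : Matrix (Fin 3) (Fin 3) K) =
      Matrix.diagonal ![d 0 / σ (d 2), d 1 / σ (d 1), d 2 / σ (d 0)] := by
  have hdet : (Matrix.diagonal d).det ≠ 0 := by
    rw [← hδ, ← Matrix.GeneralLinearGroup.val_det_apply]; exact (Matrix.GeneralLinearGroup.det δ).ne_zero
  rw [Matrix.det_diagonal] at hdet
  have hd : ∀ i, d i ≠ 0 := fun i => (Finset.prod_ne_zero_iff.1 hdet) i (Finset.mem_univ i)
  -- the matrix of `δ⁻¹`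
  have hinv : ((δ⁻¹ : GL (Fin 3) K) : Matrix (Fin 3) (Fin 3) K) = Matrix.diagonal fun i => (d i)⁻¹ := by
    rw [Matrix.coe_units_inv, hδ]
    refine Matrix.inv_eq_right_inv ?_
    rw [Matrix.diagonal_mul_diagonal, ← Matrix.diagonal_one]
    congr 1
    funext i
    exact mul_inv_cancel₀ (hd i)
  have hΘ : ∀ i j, ((UnitaryGroup.qsInvolution σ δ : GL (Fin 3) K) : Matrix (Fin 3) (Fin 3) K) i j =
      σ (Matrix.diagonal (fun i => (d i)⁻¹) j.rev i.rev) := by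
    intro i j
    rw [UnitaryGroup.coe_qsInvolution_apply, hinv]
  have hdiag : (Matrix.diagonal (fun i => (d i)⁻¹) : Matrix (Fin 3) (Fin 3) K) = !![(d 0)⁻¹, 0, 0; 0, (d 1)⁻¹, 0; 0, 0, (d 2)⁻¹] := by
    ext i j; fin_cases i <;> fin_cases j <;> simp
  have hdiagd : (Matrix.diagonal d : Matrix (Fin 3) (Fin 3) K) = !![d 0, 0, 0; 0, d 1, 0; 0, 0, d 2] := by
    ext i j; fin_cases i <;> fin_cases j <;> simp
  have hΘm : ((UnitaryGroup.qsInvolution σ δ : GL (Fin 3) K) : Matrix (Fin 3) (Fin 3) K) = !![σ (d 2)⁻¹, 0, 0; 0, σ (d 1)⁻¹, 0; 0, 0, σ (d 0)⁻¹] := by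
    ext i j
    rw [hΘ, hdiag]
    fin_cases i <;> fin_cases j <;> simp [Fin.rev]
  rw [Units.val_mul, hδ, hΘm, hdiagd]
  ext i j
  fin_cases i <;> fin_cases j <;> simp [Matrix.mul_apply, Fin.sum_univ_three, Matrix.diagonal, div_eq_mul_inv]

include hσ hσc in
/-- **HEAD 3 — `epsTwistedUnipotentModulus_diagonal_eq_weylDiscriminant_norm`, the dealer's name.**  The ε-twisted orbital substitution of §4 with
the Jacobian WRITTEN AT THE NORM: for `δ = diag(d)` ε-regular, every Haar `μN` on `N₃` and every measurable `Φ ≥ 0`,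
**`∫⁻ Φ(n·δ·Θ(n)⁻¹) dμN = (‖a − 1‖_K · √‖b − 1‖_K)⁻¹ · ∫⁻ Φ(δ·n) dμN`**, `a = (d₀∕σd₂)⁻¹(d₁∕σd₁)`, `b = (d₀∕σd₂)⁻¹(d₂∕σd₀)` the root values of
`N(δ) = diag(d₀∕σd₂, d₁∕σd₁, d₂∕σd₀)` (`coe_mul_qsInvolution_of_diagonal`) — «`∫ φ(g⁻¹δε(g)) = ∫ D_G(N(δ)) …`», print p. 59.
[cite: Rogawski1990, §4.10 Prop. 4.10.2 proof p. 59; §4.9 (4.9.1)–(4.9.2) p. 55] -/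
theorem epsTwistedUnipotentModulus_diagonal_eq_weylDiscriminant_norm (hσ1 : ∃ x, σ x ≠ x)
    [MeasurableSpace (GL (Fin 3) K)] [BorelSpace (GL (Fin 3) K)]
    (δ : GL (Fin 3) K) (d : Fin 3 → K) (hδ : (δ : Matrix (Fin 3) (Fin 3) K) = Matrix.diagonal d)
    (ha : d 2 / d 1 * σ (d 1 / d 0) - 1 ≠ 0) (hb : 1 - d 2 / d 0 * σ (d 2 / d 0) ≠ 0)
    (μN : Measure ↥(upperUnitriangular (Fin 3) K)) [IsHaarMeasure μN]
    (Φ : GL (Fin 3) K → ℝ≥0∞) (hΦ : Measurable Φ) :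
    ∫⁻ n, Φ ((n : GL (Fin 3) K) * δ * (UnitaryGroup.qsInvolution σ (n : GL (Fin 3) K))⁻¹) ∂μN =
      (((normAbs K ((d 0 / σ (d 2))⁻¹ * (d 1 / σ (d 1)) - 1) *
          NNReal.sqrt (normAbs K ((d 0 / σ (d 2))⁻¹ * (d 2 / σ (d 0)) - 1)))⁻¹ : ℝ≥0) : ℝ≥0∞) *
        ∫⁻ n, Φ (δ * (n : GL (Fin 3) K)) ∂μN := by
  have hd := diagonal_entries_ne_zero δ d hδ
  rw [← twistedJacobian_eq_inv_normAbs_norm σ hσ hσc d (hd 0) (hd 1) (hd 2)]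
  exact lintegral_mul_mul_qsInvolution_inv_eq_mul σ hσ hσc hσ1 δ d hδ ha hb μN Φ hΦ

end Norm

end Summit.HodgeConjecture.HodgeConjecture.R90.S6

end
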